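import Summits.QuantumFields.BalabanUV.T4Continuum.Support.GradedLineAveragingTwoLevel
import Summits.QuantumFields.BalabanUV.T4Continuum.Support.GradedLineAveragingBounds

/-!
# T⁴ programme, spine node NE2 (U1a), sub-row Δ1 «the graded well» — leaf (GW-E), summand (E4), PART 2c: THE TWO-LEVEL COMMUTATOR OF ONE
# WEIGHTED SCALE-`s` LINE-MASS LAYER WITH KING's PLANTING, `‖J_L·(κ Q_sᴴ P Q_s) − (L^d κ · Q_{L·s}ᴴ P Q_{L·s})·J_L‖ ≤ 3κ·s^{−d}·s⁻¹`
# (E3's `LineAveragingMassCommutator.opNorm_JK_massComm_le` PER SCALE, with a row weight `P`)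

NE2 formalisation swarm `b2b-balaban-t4-ne2-formalise-*`, LEAF PROVER 10 (gen 7); INTENT / CLAIM journal `CLAIMS.log` l.26596.  Owner rulings
R49 / R50; consumer = leaf-06-g8's `GradedWellConsistencyTransfer.towerLimitRate_GW_of_laws` (p246846), slot `hMc` for the graded mass
`MGW = QvGWᴴ·QvGW`.  The graded vector averaging `QvGW` puts on layer `i` the straight-contour average `avgS` at scale `s_i = L^{k−i}` with weight
`w_i = L^i·√(s_i^d)`, restricted to the rows of print's `st`-convention; so `MGW = Σ_i w_i²·Q_{s_i}ᴴ·P_i·Q_{s_i}` with `P_i` a diagonal 0/1 row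
weight, and at level `k+1` the scale is `L·s_i` and the weight `w_i² ↦ L^d·w_i²`.  THIS FILE proves the two-level commutator estimate for ONE
such layer, generically in the scale `s ∣ n`, the weight `κ ≥ 0` and ANY contraction `P` on the scale-`s` rows:

 * §1 `avgSL := (avgS_{L·s}).submatrix liftAV id` (the level-`k+1` average with level-`k` row indices), **`sqrt_smul_avgSL_mul_JK`**:
   `√(L^d)·(Q_{L·s}∘lift)·J_L = Q_s·(1 + c_L(S_1 − 1))` (leaf-03-g9's PART 1 `sqrt_smul_avgS_JK_apply` read as a MATRIX identity),
   `opNorm_submatrix_equiv_id_le` (row relabelling does not increase the norm), `opNorm_avgSL_le : ‖Q_{L·s}∘lift‖ ≤ (√((L·s)^d))⁻¹`;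
 * §2 **`opNorm_JK_massComm_scale_le (hs : s ∣ n) (hP : ‖P‖ ≤ 1) (hκ : 0 ≤ κ) :
   ‖J_L·(κ•(Q_sᴴ·P·Q_s)) − ((L^d·κ)•((Q_{L·s}∘lift)ᴴ·P·(Q_{L·s}∘lift)))·J_L‖ ≤ 3·κ·(s^d)⁻¹·s⁻¹`** — E3's cancellation VERBATIM: with
   `J_Lᴴ = √(L^d)·Qavg_L`, PART 1 and PART 2b (`Q_s·Qavg_L = Q_{L·s}∘lift + D`) the leading terms `κ√(L^d)·(Q_{L·s}∘lift)ᴴ·P·Q_s` CANCEL EXACTLY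
   (`κ·√(L^d) = (L^d κ)·(√(L^d))⁻¹`), leaving `ρ·Dᴴ·P·Q_s − ρ c_L·(Q_{L·s}∘lift)ᴴ·P·Q_s(S_1 − 1)`, `ρ = κ√(L^d)`, of norm `≤ (2 + 1)·κ·s^{−d}·s⁻¹` by
   PART 2a's `opNorm_avgS_le` / `opNorm_avgS_mul_shiftT_sub_one_le` and PART 2b's `opNorm_defectS_le`.
 At `s = n`, `P = 1`, `κ = a n^d` this is E3's `3a·n⁻¹`.  PART 2d (`GradedWellMassCommutator`) sums the layers into `hMc`.

HONEST FRAMING (T4-DAG p. 1).  `U = 1`; finite torus; Bałaban's (1.18) averaging at a sub-block scale and King's planting (2.10) as the tree types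
them; exact lattice identities, Cauchy–Schwarz and the triangle inequality only; statements, pairings and constants OURS ([folklore]; the `[cite:]`
tags locate printed OBJECTS); ONE layer of ONE displayed input (`hMc`) of ONE junction of the Δ1 graded-well END is served; (E4) / `hMc` / the END
OPEN; NE2 (U1a) NOT proved; spine PROVED 0/9 unchanged; NOT [B9] (3.16)/(3.23)–(3.27)/(3.42) as printed; NOT infinite volume, NOT a mass gap, NOT
the Clay problem.  HONEST DEPENDENCY: continuum YM on T⁴ ⇐ BetaPertH ∧ nine spine estimates (0/9 proved); BetaPertH ⇐ (D1) ∧ (D4) ∧ CAP+tail;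
G-an2-4 gates asym, D1 and NE2/3/4.  No `sorry`.
-/

noncomputable section

open scoped BigOperators ComplexConjugate Matrix Matrix.Norms.L2Operator
open Finset

namespace Summit.QuantumFields.BalabanUV.T4Continuum.GradedLineMassCommutatorScale

open Literature.MathematicalPhysics.QuantumFieldTheory.Balaban1983to89.B5Prop11Plancherel (Tor fine)
open Literature.MathematicalPhysics.QuantumFieldTheory.Balaban1983to89.B5Prop11Lower (nsq nsq_nonneg)
open Literature.MathematicalPhysics.QuantumFieldTheory.Balaban1983to89.B5G183RateTorusW (Qavg)
open Summit.QuantumFields.BalabanUV.T4Continuum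
open Summit.QuantumFields.BalabanUV.T4Continuum.BalabanLineAverage (shiftT)
open Summit.QuantumFields.BalabanUV.T4Continuum.BalabanBlockPoincare (nsq_mulVec_le_rect)
open Summit.QuantumFields.BalabanUV.T4Continuum.CovariantBlockAveraging (opNorm_le_of_sq_le')
open Summit.QuantumFields.BalabanUV.T4Continuum.KingPairingPlantedLaw (JK sqrt_facts)
open Summit.QuantumFields.BalabanUV.T4Continuum.LineAveragingPairing (cL norm_cL_le)
open Summit.QuantumFields.BalabanUV.T4Continuum.GradedSubBlocks (Anc avgS)
open Summit.QuantumFields.BalabanUV.T4Continuum.GradedLineAveragingPairing (sqrt_smul_avgS_JK_apply)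
open Summit.QuantumFields.BalabanUV.T4Continuum.GradedLineAveragingBounds (opNorm_avgS_le opNorm_avgS_mul_shiftT_sub_one_le)
open Summit.QuantumFields.BalabanUV.T4Continuum.GradedLineAveragingTwoLevel (liftA liftAV val_liftA defectS opNorm_defectS_le)

variable {d : ℕ} (n L : ℕ) [NeZero n] [NeZero L] (M : Fin d → ℕ) [hM : ∀ μ, NeZero (M μ)] (s : ℕ) [NeZero s]

/-! ## §1 The lifted scale-`L·s` average as a matrix on level-`k` row indices -/

/-- **THE SCALE-`L·s` AVERAGE OF THE REFINED TORUS WITH LEVEL-`k` ROW INDICES**: `Q_{L·s}∘lift`, rows `(z, μ) ↦ (cpt z, μ)`.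
[cite: Balaban1984PropagatorsI, (1.18) p.20 (shape)] [folklore] -/
def avgSL : Matrix (Anc (fine n M) s × Fin d) (Tor (fine (L * n) M) × Fin d) ℂ :=
  (avgS (fine (L * n) M) (L * s)).submatrix (liftAV n L M s) id

omit [NeZero s] in
/-- `Q_s·Qavg_L − Q_{L·s}∘lift` is PART 2b's defect matrix. [folklore] -/
theorem avgS_mul_Qavg_sub_avgSL : avgS (fine n M) s * Qavg n L M - avgSL n L M s = defectS n L M s := rfl

/-- **THE FIRST PAIRING IDENTITY AT SCALE `s` AS A MATRIX IDENTITY**: `√(L^d)·(Q_{L·s}∘lift)·J_L = Q_s·(1 + c_L(S_1 − 1))` (leaf-03-g9's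
`sqrt_smul_avgS_JK_apply`, row by row at the lifted anchors). [cite: Balaban1984PropagatorsI, (1.18) p.20; King1986, (2.10) p.653 (shapes)] [folklore] -/
theorem sqrt_smul_avgSL_mul_JK (hs : s ∣ n) :
    ((((Real.sqrt ((L : ℝ) ^ d)) : ℝ) : ℂ)) • (avgSL n L M s * JK n L M)
      = avgS (fine n M) s * (1 + cL L • (shiftT (fine n M) 1 - 1)) := by
  rw [Matrix.ext_iff_mulVec]
  intro f
  funext b
  obtain ⟨z, μ⟩ := b
  rw [Matrix.smul_mulVec, Pi.smul_apply, smul_eq_mul, ← Matrix.mulVec_mulVec, ← Matrix.mulVec_mulVec]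
  exact sqrt_smul_avgS_JK_apply n L s M hs f z (liftA n L M s z) (val_liftA n L M s z) μ

omit hM in
/-- relabelling the rows along an equivalence does not increase the operator norm. [folklore] -/
theorem opNorm_submatrix_equiv_id_le {ι κ τ : Type*} [Fintype ι] [Fintype κ] [Fintype τ] [DecidableEq ι] [DecidableEq κ]
    [DecidableEq τ] (A : Matrix κ τ ℂ) (e : ι ≃ κ) : ‖A.submatrix e id‖ ≤ ‖A‖ := by
  refine opNorm_le_of_sq_le' _ (norm_nonneg A) fun x => ?_
  have h1 : ∑ i, ‖∑ j, A.submatrix e id i j * x j‖ ^ 2 = ∑ i', ‖∑ j, A i' j * x j‖ ^ 2 :=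
    e.sum_comp (fun i' => ‖∑ j, A i' j * x j‖ ^ 2)
  rw [h1]
  exact nsq_mulVec_le_rect A x

/-- `‖Q_{L·s}∘lift‖ ≤ (√((L·s)^d))⁻¹` (PART 2a's `opNorm_avgS_le` at scale `L·s`, rows relabelled). [folklore] -/
theorem opNorm_avgSL_le (hs : s ∣ n) : ‖avgSL n L M s‖ ≤ (Real.sqrt ((((L * s : ℕ) : ℝ)) ^ d))⁻¹ := by
  have hLs : ∀ ν, L * s ∣ fine (L * n) M ν := fun ν => by
    show L * s ∣ L * n * M ν
    exact Dvd.dvd.mul_right (Nat.mul_dvd_mul_left L hs) (M ν)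
  have h := opNorm_avgS_le (fine (L * n) M) (L * s) hLs
  push_cast at h ⊢
  exact (opNorm_submatrix_equiv_id_le _ _).trans h

/-! ## §2 The two-level commutator of one weighted scale-`s` line-mass layer -/

/-- **THE SCALE-`s` LINE-MASS COMMUTATOR** (one layer, weight `κ ≥ 0`, row weight `P` with `‖P‖ ≤ 1`):
`‖J_L·(κ•(Q_sᴴPQ_s)) − ((L^dκ)•((Q_{L·s}∘lift)ᴴP(Q_{L·s}∘lift)))·J_L‖ ≤ 3·κ·(s^d)⁻¹·s⁻¹` — the leading terms cancel exactly
(`κ·√(L^d) = (L^dκ)·(√(L^d))⁻¹`), leaving `ρ·DᴴPQ_s − ρc_L·(Q_{L·s}∘lift)ᴴPQ_s(S_1 − 1)` with `ρ = κ√(L^d)`, `‖D‖ ≤ 2s⁻¹(√((Ls)^d))⁻¹`,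
`‖Q_s(S_1 − 1)‖ ≤ 2s⁻¹(√(s^d))⁻¹`, `|c_L| ≤ ½`.  At `s = n`, `P = 1`, `κ = a n^d`: E3's `3a/n`.  Statement and proof OURS.
[cite: Balaban1984PropagatorsI, (1.18) p.20; King1986, (2.10) p.653 (shapes)] [folklore] -/
theorem opNorm_JK_massComm_scale_le (hs : s ∣ n) (P : Matrix (Anc (fine n M) s × Fin d) (Anc (fine n M) s × Fin d) ℂ)
    (hP : ‖P‖ ≤ 1) (κ : ℝ) (hκ : 0 ≤ κ) :
    ‖JK n L M * (((κ : ℝ) : ℂ) • ((avgS (fine n M) s)ᴴ * P * avgS (fine n M) s))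
        - ((((L : ℝ) ^ d * κ : ℝ) : ℂ) • ((avgSL n L M s)ᴴ * P * avgSL n L M s)) * JK n L M‖
      ≤ 3 * κ * (((s : ℝ) ^ d))⁻¹ * ((s : ℝ))⁻¹ := by
  have hs0 : (0 : ℝ) < s := by exact_mod_cast Nat.pos_of_ne_zero (NeZero.ne s)
  have hL : (0 : ℝ) < L := by exact_mod_cast Nat.pos_of_ne_zero (NeZero.ne L)
  have hsd : (0 : ℝ) < (s : ℝ) ^ d := pow_pos hs0 d
  have hLd : (0 : ℝ) < (L : ℝ) ^ d := pow_pos hL d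
  have hsL : 0 < Real.sqrt ((L : ℝ) ^ d) := Real.sqrt_pos.mpr hLd
  have hsn : ∀ ν, s ∣ fine n M ν := fun ν => Dvd.dvd.mul_right hs (M ν)
  obtain ⟨hstar, hss⟩ := sqrt_facts (d := d) L
  set σ : ℂ := (((Real.sqrt ((L : ℝ) ^ d)) : ℝ) : ℂ) with hσ
  have hσ0 : σ ≠ 0 := by rw [hσ]; exact_mod_cast hsL.ne'
  set Q := avgS (fine n M) s with hQ
  set Q' := avgSL n L M s with hQ'
  set J := JK n L M with hJ
  set D := defectS n L M s with hD
  set T := Q * (shiftT (fine n M) 1 - 1) with hT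
  set kap : ℂ := ((κ : ℝ) : ℂ) with hkap
  set kap' : ℂ := ((((L : ℝ) ^ d * κ : ℝ)) : ℂ) with hkap'
  -- the two pairing identities
  have hJH : Jᴴ = σ • Qavg n L M := by
    rw [hJ, JK, Matrix.conjTranspose_smul, Matrix.conjTranspose_conjTranspose, hstar]
  have hQD : Q * Qavg n L M = Q' + D := by rw [hD, ← avgS_mul_Qavg_sub_avgSL, hQ, hQ']; abel
  have h1 : J * Qᴴ = σ • (Q'ᴴ + Dᴴ) := by
    have e : J * Qᴴ = (Q * Jᴴ)ᴴ := by rw [Matrix.conjTranspose_mul, Matrix.conjTranspose_conjTranspose]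
    rw [e, hJH, Matrix.mul_smul, Matrix.conjTranspose_smul, hstar, hQD, Matrix.conjTranspose_add]
  have h2 : Q' * J = σ⁻¹ • (Q + cL L • T) := by
    have e : σ • (Q' * J) = Q + cL L • T := by
      rw [hQ', hJ, hσ, sqrt_smul_avgSL_mul_JK n L M s hs, Matrix.mul_add, Matrix.mul_one, Matrix.mul_smul]
    rw [← e, smul_smul, inv_mul_cancel₀ hσ0, one_smul]
  -- the scalar bookkeeping `κ·σ = κ′·σ⁻¹ =: ρ`
  have hρ : kap' * σ⁻¹ = kap * σ := by
    rw [mul_inv_eq_iff_eq_mul₀ hσ0, mul_assoc, hss, hkap, hkap']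
    push_cast; ring
  -- THE CANCELLATION
  have e1 : J * (kap • (Qᴴ * P * Q)) = (kap * σ) • (Q'ᴴ * P * Q) + (kap * σ) • (Dᴴ * P * Q) := by
    rw [Matrix.mul_smul, ← Matrix.mul_assoc, ← Matrix.mul_assoc, h1, Matrix.smul_mul, Matrix.smul_mul, Matrix.add_mul,
      Matrix.add_mul]
    simp only [smul_add, smul_smul]
  have e2 : (kap' • (Q'ᴴ * P * Q')) * J = (kap' * σ⁻¹) • (Q'ᴴ * P * Q) + (kap' * σ⁻¹ * cL L) • (Q'ᴴ * P * T) := by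
    rw [Matrix.smul_mul, Matrix.mul_assoc, h2, Matrix.mul_smul, Matrix.mul_add, Matrix.mul_smul]
    simp only [smul_add, smul_smul, mul_assoc]
  have hX : J * (kap • (Qᴴ * P * Q)) - (kap' • (Q'ᴴ * P * Q')) * J = (kap * σ) • (Dᴴ * P * Q) - (kap * σ * cL L) • (Q'ᴴ * P * T) := by
    rw [e1, e2, hρ]
    abel
  rw [hX]
  -- norms of the pieces
  have hq : ‖Q‖ ≤ (Real.sqrt ((s : ℝ) ^ d))⁻¹ := opNorm_avgS_le (fine n M) s hsn
  have hq' : ‖Q'ᴴ‖ ≤ (Real.sqrt (((L * s : ℕ) : ℝ) ^ d))⁻¹ := by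
    rw [Matrix.l2_opNorm_conjTranspose]; exact opNorm_avgSL_le n L M s hs
  have hDn : ‖Dᴴ‖ ≤ 2 * ((s : ℝ))⁻¹ * (Real.sqrt (((L * s : ℕ) : ℝ) ^ d))⁻¹ := by
    rw [Matrix.l2_opNorm_conjTranspose]; exact opNorm_defectS_le n L M s hs
  have hTn : ‖T‖ ≤ 2 * ((s : ℝ))⁻¹ * (Real.sqrt ((s : ℝ) ^ d))⁻¹ := opNorm_avgS_mul_shiftT_sub_one_le (fine n M) s hsn
  have hcL : ‖cL L‖ ≤ 1 / 2 := norm_cL_le L (Nat.pos_of_ne_zero (NeZero.ne L))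
  have hκσ : ‖kap * σ‖ = κ * Real.sqrt ((L : ℝ) ^ d) := by
    rw [norm_mul, hkap, hσ, Complex.norm_real, Complex.norm_real, Real.norm_of_nonneg hκ, Real.norm_of_nonneg hsL.le]
  have hsqLs : Real.sqrt (((L * s : ℕ) : ℝ) ^ d) = Real.sqrt ((L : ℝ) ^ d) * Real.sqrt ((s : ℝ) ^ d) := by
    rw [← Real.sqrt_mul hLd.le]; push_cast; rw [mul_pow]
  have hq0 : 0 ≤ (Real.sqrt ((s : ℝ) ^ d))⁻¹ := inv_nonneg.mpr (Real.sqrt_nonneg _)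
  have hq0' : 0 ≤ (Real.sqrt (((L * s : ℕ) : ℝ) ^ d))⁻¹ := inv_nonneg.mpr (Real.sqrt_nonneg _)
  have hP0 : 0 ≤ ‖P‖ := norm_nonneg _
  have hDPQ : ‖Dᴴ * P * Q‖ ≤ (2 * ((s : ℝ))⁻¹ * (Real.sqrt (((L * s : ℕ) : ℝ) ^ d))⁻¹) * 1 * (Real.sqrt ((s : ℝ) ^ d))⁻¹ :=
    calc ‖Dᴴ * P * Q‖ ≤ ‖Dᴴ * P‖ * ‖Q‖ := Matrix.l2_opNorm_mul _ _
      _ ≤ (‖Dᴴ‖ * ‖P‖) * ‖Q‖ := mul_le_mul_of_nonneg_right (Matrix.l2_opNorm_mul _ _) (norm_nonneg _)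
      _ ≤ _ := mul_le_mul (mul_le_mul hDn hP (norm_nonneg _) (by positivity)) hq (norm_nonneg _) (by positivity)
  have hQPT : ‖Q'ᴴ * P * T‖ ≤ (Real.sqrt (((L * s : ℕ) : ℝ) ^ d))⁻¹ * 1 * (2 * ((s : ℝ))⁻¹ * (Real.sqrt ((s : ℝ) ^ d))⁻¹) :=
    calc ‖Q'ᴴ * P * T‖ ≤ ‖Q'ᴴ * P‖ * ‖T‖ := Matrix.l2_opNorm_mul _ _
      _ ≤ (‖Q'ᴴ‖ * ‖P‖) * ‖T‖ := mul_le_mul_of_nonneg_right (Matrix.l2_opNorm_mul _ _) (norm_nonneg _)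
      _ ≤ _ := mul_le_mul (mul_le_mul hq' hP (norm_nonneg _) hq0') hTn (norm_nonneg _) (by positivity)
  calc ‖(kap * σ) • (Dᴴ * P * Q) - (kap * σ * cL L) • (Q'ᴴ * P * T)‖
      ≤ ‖(kap * σ) • (Dᴴ * P * Q)‖ + ‖(kap * σ * cL L) • (Q'ᴴ * P * T)‖ := norm_sub_le _ _
    _ = ‖kap * σ‖ * ‖Dᴴ * P * Q‖ + ‖kap * σ‖ * ‖cL L‖ * ‖Q'ᴴ * P * T‖ := by rw [norm_smul, norm_smul, norm_mul (kap * σ)]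
    _ ≤ (κ * Real.sqrt ((L : ℝ) ^ d)) * ((2 * ((s : ℝ))⁻¹ * (Real.sqrt (((L * s : ℕ) : ℝ) ^ d))⁻¹) * 1 * (Real.sqrt ((s : ℝ) ^ d))⁻¹)
        + (κ * Real.sqrt ((L : ℝ) ^ d)) * (1 / 2)
          * ((Real.sqrt (((L * s : ℕ) : ℝ) ^ d))⁻¹ * 1 * (2 * ((s : ℝ))⁻¹ * (Real.sqrt ((s : ℝ) ^ d))⁻¹)) := by
        rw [hκσ]
        have hA : 0 ≤ κ * Real.sqrt ((L : ℝ) ^ d) := by positivity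
        refine add_le_add (mul_le_mul_of_nonneg_left hDPQ hA) ?_
        exact mul_le_mul (mul_le_mul_of_nonneg_left hcL hA) hQPT (norm_nonneg _) (by positivity)
    _ = 3 * κ * (((s : ℝ) ^ d))⁻¹ * ((s : ℝ))⁻¹ := by
        rw [hsqLs]
        set sS := Real.sqrt ((s : ℝ) ^ d) with hsS
        set sL := Real.sqrt ((L : ℝ) ^ d) with hsL'
        have h1' : sS ≠ 0 := (Real.sqrt_pos.mpr hsd).ne'
        have h2' : sL ≠ 0 := hsL.ne'
        have h3' : (s : ℝ) ≠ 0 := hs0.ne'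
        have h4' : sS * sS = (s : ℝ) ^ d := Real.mul_self_sqrt hsd.le
        rw [← h4']
        field_simp
        ring

end Summit.QuantumFields.BalabanUV.T4Continuum.GradedLineMassCommutatorScale

end
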